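import Summits.QuantumFields.YangMills.Theorems.UnitScaleTiltProp7PinnedSliceRowOfThm2Datum
import Summits.QuantumFields.YangMills.Theorems.UnitScaleTiltProp7DatumOfThm2S
import HarnessLib

/-!
# Route `UnitScaleTilt`, crux K1 «MinimiserStabilityRegPr» (stmt-QuantumFields-19200), route-R E′ path (α′), (E1) «pinned slice theorem»: THE (E1)-DOOR KNIT AT THE
# MEMBERS OF RECORD — the member-level twin of ✓ `Prop7PinnedSliceRowOfThm2Datum.pinnedSliceRow_of_thm2Datum`, whose two sockets `hDatum` (Thm-2 datum) and `hLrow`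
# ((E1-b) gauge row) are asked ONLY behind the member prefix «`a′` with `8 ≤ L^{a′}`, `a′ + 3 ≤ F.m + n`, regime `(L·L^{a′})·e ≤ a₅`» — the prefix under which the
# tree SUPPLIES them: ✓ `Prop7DatumOfThm2S.hDatum_of_thm2S_member` (ym3-torus-px13 g4: the datum from the EX knit's [B8]-Theorem-2 binder `hThm2S`, print's (1.72)
# ✓ `Prop7Thm2GaugeCentreValues.dist1_centre_le_of_axial_restricted`, the (3.35) frames ✓ `exists_frames_T3_of_regPr`) and ✓ `Prop7LinCorrRowOfHKsup.hLrow_of_hKsup_member`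
# (the L-row from `hKsup`)

Cell `ym3-torus`, width seat `ym-ust-19200-w1` (gen 13); row «HDATUM E2E AT THE MEMBER» (ym3-torus-px13 g4's offer 2026-08-29 01:31Z, taken 01:31Z).  THEOREMS ONLY (0 `def`,
0 `sorry`, 0 `instance`); `--supports stmt-QuantumFields-19200`, count-neutral.  YM₃ on T³ is a ladder rung (R3) — not d = 4, not infinite volume, not a mass gap, not the Clay
problem; nothing here claims a stub, the crux or (E1): door algebra (quantifier plumbing) over ✓ `pinnedSlice_of_untwistedStart_of_linCorrRow`, every analytic row is a socket.

WHY.  The E′ display's E1 side (✓ `Prop7PV3EOfRawRowsTwoSided`, ★p1 g16∕g17) consumes the (E1) conjunct through the door ✓p683555, whose sockets are quantified over EVERY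
member `F` with `F.L = L`.  Their suppliers of record live at the MEMBERS OF RECORD `⟨ℓ+1, hL, m, hm⟩` and carry the member prefix of [Balaban1985BackgroundPropagators]
(3.35)-type frame∕kernel estimates (`a′`: the auxiliary exponent with `8 ≤ L^{a′}`; `a′ + 3 ≤ m + n`: the torus is large enough for the `R = 2L²`-cones; the regime
`(L·L^{a′})·e ≤ a₅`): px13 g4's `hDatum_of_thm2S_member` concludes EXACTLY the `hDatum` body behind that prefix (constants `s₀ := 2B₁′e₆`, `s₁′ := 6B₁′e₆`, `σ := 240B₁′e₆`,
`c₀ = c₁ := c35·a₅·e^{c35·a₅}`), and `hLrow_of_hKsup_member` the `hLrow` body at `F := ⟨ℓ+1, hL, m, hm⟩` from `hKsup`.  THIS FILE re-cuts the door so that both enter by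
`exact`∕`intro`: same proof spine (`obtain` the datum, `subst`, ✓ `pinnedSlice_of_untwistedStart_of_linCorrRow` at the member's `hLrowM`), member prefix DISPLAYED in both
binders and in the conclusion.  The crux quantifies `∃ m₀, ∀ m ≥ m₀`, so the assembler meets `a′ + 3 ≤ F.m + n` by `m₀ ≥ a′(L) + 3` with `a′(L)` the least exponent with
`8 ≤ L^{a′}`.

WHAT IS PROVED (ns `…Theorems.Prop7PinnedSliceRowMember`; `ℓ := L^{K−n}`).
* ★★★ `pinnedSliceRow_member_of_thm2Datum (L) {e₆ sQ s C s₀ s₁' σ c₀ c₁ a₅} (hC) (windows of ✓p683555 VERBATIM) (hsQ : sQ = 2s + 9Cs) (hDatumM) (hLrowM)` — for every `F` with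
  `F.L = L`, every `n < K`, `a′` with `a′ + 3 ≤ F.m + n`, `8 ≤ L^{a′}`, every `0 < e ≤ e₆` with `(L·L^{a′})·e ≤ a₅`, every `W ∈ (6)(e) ∩ 𝔅_k(V)` critical (`IsCritR2`) and every
  competitor `W′ ∈ (6)(e) ∩ 𝔅_k(V)`: `∃ Y ∈ (6)(e) ∩ 𝔅_k(V)`, `A(W′) = A(Y)`, `‖↑(Y_bW_b⁻¹) − 1‖ ≤ sQ·ℓ⁻¹`, and `S_H` off the centres — the (E1) conjunct of
  ✓ `stub_PV3E_of_pinnedSliceAndRawRows_abs`'s `hrows` BEHIND THE MEMBER PREFIX; `hDatumM` = ✓p683555's `hDatum` body behind the prefix (no criticality asked —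
  ✓ `hDatum_of_thm2S_member`'s conclusion shape at `L := ℓ + 1`), `hLrowM` = ✓p683555's `hLrow` body behind the same prefix.
HONEST SCOPE.  Door algebra; no analytic estimate is proved here; (E1), E′, the crux are NOT claimed; the sockets' suppliers are named above and are not restated.

References: T. Bałaban, CMP **102** (1985) 277–309 [Balaban1985Variational] (Prop. 7 p.299, (4)–(7) p.278, (141)–(143) p.299); CMP **99** (1985) 75–102 [Balaban1985RegularSpaces]
(Thm 2 p.83, (1.36) p.82, (1.72) p.88); CMP **99** (1985) 389–434 [Balaban1985BackgroundPropagators] ((3.3) p.390, (3.8) p.392, (3.35) p.396); CMP **98** (1985) 17–51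
[Balaban1985Averaging] ((21)–(23) p.21).
-/

set_option autoImplicit false

noncomputable section

open scoped BigOperators Matrix.Norms.L2Operator Matrix
open NormedSpace

namespace Summit.QuantumFields.YangMills.Theorems.Prop7PinnedSliceRowMember

open Literature.MathematicalPhysics.QuantumFieldTheory.Balaban1983to89
open Literature.MathematicalPhysics.QuantumFieldTheory.Balaban1983to89.T3ContinuumYM3Torus
open Literature.MathematicalPhysics.QuantumFieldTheory.Balaban1983to89.T3PrintedRegularMinimiser (regFibrePr)
open Literature.MathematicalPhysics.QuantumFieldTheory.Balaban1983to89.T3SectALandauChart (emb15)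
open Literature.MathematicalPhysics.QuantumFieldTheory.Balaban1983to89.T3Thm1CarrierNative (IsCritR2)
open T4Continuum
open MatrixLog (mlog)
open B9Eq39Adjoint (covD divB)
open B9TorusCalculus (torusT)
open B15DeterminingSets (embIter)
open B10Eq27TorusAxialLog (unitsField toUField)
open B5Eq118OneStroke (iterBlockOf)
open Summit.QuantumFields.YangMills.Theorems.Prop7TPrint (expHermField)
open Summit.QuantumFields.YangMills.Theorems.Prop7PinnedSliceOfLinCorrRow (pinnedSlice_of_untwistedStart_of_linCorrRow)
open Summit.QuantumFields.YangMills.Theorems.Prop7PinnedSliceRowOfThm2Datum (forty_mul_le_pow)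
open Summit.QuantumFields.YangMills.Theorems.Prop7DatumOfThm2S (hDatum_of_thm2S_member)
open B7Prop1Explicit renaming Site → LSite
open B7Prop2Explicit (C0 c2')
open B7Prop3Flat (c3)
open B8Thm2SetupTorus (Thm2SetupSUAt)
open Literature.MathematicalPhysics.QuantumFieldTheory.Balaban1983to89.T3SectALandauChart (eta)

/-- ★★★ **THE (E1)-DOOR KNIT AT THE MEMBERS OF RECORD** — ✓ `pinnedSliceRow_of_thm2Datum` with both sockets asked only behind the member prefix «`a′`, `a′ + 3 ≤ F.m + n`,
`8 ≤ L^{a′}`, `(L·L^{a′})·e ≤ a₅`» (the shape ✓ `hDatum_of_thm2S_member` and ✓ `hLrow_of_hKsup_member` supply), concluding the (E1) conjunct of the E′ display behind the same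
prefix; windows and `sQ = 2s + 9Cs` as in the door.
[cite: Balaban1985Variational, Prop. 7 p.299, (141)-(143) p.299; Balaban1985RegularSpaces, Thm 2 p.83, (1.36) p.82, (1.72) p.88; Balaban1985BackgroundPropagators, (3.3) p.390, (3.8) p.392, (3.35) p.396] -/
theorem pinnedSliceRow_member_of_thm2Datum (L : ℕ) {e₆ sQ s C s₀ s₁' σ c₀ c₁ a₅ : ℝ} (hC : 0 ≤ C)
    -- (c) print's windows on the datum constants, the chart size `s` dominating w1's `S₁`, `S₂` (d = 3), the knit's windows, and `sQ` AS AN EQUALITY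
    (hs₀' : s₀ ≤ 1 / 64) (hσ0 : σ ≤ 1 / 1024) (hσc : ((6 + 2 * c₀) * (2 * σ)) ≤ 1 / 256)
    (hS₁ : (s₀ + (1 + 2 * s₀) * ((1 + 6 * σ) * ((6 + 2 * c₀) * (2 * σ)))) ≤ s)
    (hS₂ : (s₁' + (3 : ℝ) * (((2 * (c₁ + 2 * c₀ ^ 2) + 24 * c₀ + 24) * (2 * σ)) + 9 * ((6 + 2 * c₀) * (2 * σ)) ^ 2 + 36 * σ * ((2 * (c₁ + 2 * c₀ ^ 2) + 24 * c₀ + 24) * (2 * σ))) + (3 : ℝ) * (6 * ((6 + 2 * c₀) * (2 * σ)) * s₀ + 4 * s₀ * ((1 + 6 * σ) * ((6 + 2 * c₀) * (2 * σ))))) ≤ s)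
    (hs40 : 40 * s ≤ (L : ℝ))
    (hwin1 : 1800 * C * s ≤ 1) (hwin2 : 3 / 2 * C * (400 * (1 + 3)) * (7 * (3 / 2 * C) * s + s) ≤ 1 / 2)
    (hsQ : sQ = 2 * s + 9 * C * s)
    -- (a) THE THM-2 DATUM SOCKET AT MEMBERS OF RECORD (✓ `pinnedSliceRow_of_thm2Datum`'s `hDatum` body behind the member prefix = ✓ `hDatum_of_thm2S_member`'s conclusion shape)
    (hDatumM :
    ∀ (F : T3Family), F.L = L → ∀ (n K a' : ℕ) (hnK : n < K), a' + 3 ≤ F.m + n → 8 ≤ L ^ a' →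
    ∀ (e : ℝ) (V : GaugeField (F.P n) 0 (Matrix.specialUnitaryGroup (Fin 2) ℂ)) (W : GaugeField (F.P K) 0 (Matrix.specialUnitaryGroup (Fin 2) ℂ)),
      0 < e → e ≤ e₆ → (L : ℝ) * ((L ^ a' : ℕ) : ℝ) * e ≤ a₅ → W ∈ regFibrePr F n K hnK.le e V →
      ∀ W' : GaugeField (F.P K) 0 (Matrix.specialUnitaryGroup (Fin 2) ℂ), W' ∈ regFibrePr F n K hnK.le e V →
      ∃ (A₀ : PBond (F.P K) 0 → Matrix (Fin 2) (Fin 2) ℂ) (u : GaugeTransf (F.P K) 0 (Matrix.specialUnitaryGroup (Fin 2) ℂ))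
        (Fr : Site (F.P K) (K - n) → Site (F.P K) 0 → (Matrix (Fin 2) (Fin 2) ℂ)ˣ) (a₀ a₁ : ℝ),
        -- the competitor IS print's twisted Landau representative ([Balaban1985RegularSpaces] Thm 2, (1.29)–(1.30))
        W' = GaugeField.gaugeAct u (emb15 W (expHermField A₀)) ∧
        -- (1.36)₁₂: the Landau datum, Hermitian-traceless, `ℓ‖A₀‖ ≤ s₀`, `ℓ²‖D*_𝒰A₀‖ ≤ s₁′`
        (∀ b, (A₀ b).IsHermitian ∧ Matrix.trace (A₀ b) = 0) ∧
        ((((F.P K).L ^ (K - n) : ℕ)) : ℝ) * ‖(fun (μ : Fin (F.P K).d) (z : Site (F.P K) 0) => A₀ ⟨z, μ⟩)‖ ≤ s₀ ∧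
        ((((F.P K).L ^ (K - n) : ℕ)) : ℝ) ^ 2 * ‖(fun x => divB (torusT (F.P K) 0) (fun κ z => unitsField (toUField W) ⟨z, κ⟩) (fun μ z => A₀ ⟨z, μ⟩) x)‖ ≤ s₁' ∧
        -- (1.72): the twist's centre values
        (∀ y : Site (F.P K) (K - n), dist1 (u (embIter (K - n) y)) ≤ σ) ∧
        -- the (3.35)-type unit frames with their block rows `a₀ a₁` (`ℓa₀ ≤ c₀`, `ℓ²a₁ ≤ c₁`)
        (∀ y z, ‖(Fr y z : Matrix (Fin 2) (Fin 2) ℂ)‖ ≤ 1 ∧ ‖(((Fr y z)⁻¹ : (Matrix (Fin 2) (Fin 2) ℂ)ˣ) : Matrix (Fin 2) (Fin 2) ℂ)‖ ≤ 1) ∧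
        (∀ y, Fr y (embIter (K - n) y) = 1) ∧
        0 ≤ a₀ ∧ 0 ≤ a₁ ∧ ((((F.P K).L ^ (K - n) : ℕ)) : ℝ) * a₀ ≤ c₀ ∧ ((((F.P K).L ^ (K - n) : ℕ)) : ℝ) ^ 2 * a₁ ≤ c₁ ∧
        (∀ (y : Site (F.P K) (K - n)) (z : Site (F.P K) 0), (∀ ν : Fin (F.P K).d, (y ν = (iterBlockOf (K - n) (fun κ => z κ - (((((F.P K).L ^ (K - n) - 1) / 2 : ℕ)) : ZMod ((F.P K).sitesPerDir 0)))) ν - 1 ∨ y ν = (iterBlockOf (K - n) (fun κ => z κ - (((((F.P K).L ^ (K - n) - 1) / 2 : ℕ)) : ZMod ((F.P K).sitesPerDir 0)))) ν ∨ y ν = (iterBlockOf (K - n) (fun κ => z κ - (((((F.P K).L ^ (K - n) - 1) / 2 : ℕ)) : ZMod ((F.P K).sitesPerDir 0)))) ν + 1 ∨ y ν = (iterBlockOf (K - n) (fun κ => z κ - (((((F.P K).L ^ (K - n) - 1) / 2 : ℕ)) : ZMod ((F.P K).sitesPerDir 0)))) ν + 2)) → ∀ μ : Fin (F.P K).d,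
        ‖(((Fr y z)⁻¹ * unitsField (toUField W) ⟨z, μ⟩ * Fr y (torusT (F.P K) 0 μ z) : (Matrix (Fin 2) (Fin 2) ℂ)ˣ) : Matrix (Fin 2) (Fin 2) ℂ) - 1‖ ≤ a₀
        ∧ ‖(((Fr y ((torusT (F.P K) 0 μ).symm z))⁻¹ * unitsField (toUField W) ⟨(torusT (F.P K) 0 μ).symm z, μ⟩ * Fr y z : (Matrix (Fin 2) (Fin 2) ℂ)ˣ) : Matrix (Fin 2) (Fin 2) ℂ) - 1‖ ≤ a₀
        ∧ ‖(((Fr y z)⁻¹ * unitsField (toUField W) ⟨z, μ⟩ * Fr y (torusT (F.P K) 0 μ z) : (Matrix (Fin 2) (Fin 2) ℂ)ˣ) : Matrix (Fin 2) (Fin 2) ℂ)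
        - (((Fr y ((torusT (F.P K) 0 μ).symm z))⁻¹ * unitsField (toUField W) ⟨(torusT (F.P K) 0 μ).symm z, μ⟩ * Fr y z : (Matrix (Fin 2) (Fin 2) ℂ)ˣ) : Matrix (Fin 2) (Fin 2) ℂ)‖ ≤ a₁))
    -- (b) THE (E1-b) GAUGE-ROW SOCKET AT MEMBERS OF RECORD (✓ `pinnedSliceRow_of_thm2Datum`'s `hLrow` body behind the same member prefix)
    (hLrowM :
    ∀ (F : T3Family), F.L = L → ∀ (n K a' : ℕ) (hnK : n < K), a' + 3 ≤ F.m + n → 8 ≤ L ^ a' →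
    ∀ (e : ℝ) (V : GaugeField (F.P n) 0 (Matrix.specialUnitaryGroup (Fin 2) ℂ)) (W : GaugeField (F.P K) 0 (Matrix.specialUnitaryGroup (Fin 2) ℂ)),
      0 < e → e ≤ e₆ → (L : ℝ) * ((L ^ a' : ℕ) : ℝ) * e ≤ a₅ → W ∈ regFibrePr F n K hnK.le e V →
      ∀ (w : Site (F.P K) 0 → ℝ), (∀ (x : Site (F.P K) 0) (y : Site (F.P K) (K - n)), w x ≤ (Site.tdist x (embIter (K - n) y) : ℝ)) →
          (∀ x, w x ≤ (F.L : ℝ) ^ (K - n)) → (∀ x, 0 ≤ w x) →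
        ∃ (I : (Site (F.P K) 0 → Matrix (Fin 2) (Fin 2) ℂ) →+ (Site (F.P K) 0 → Matrix (Fin 2) (Fin 2) ℂ))
          (L : (Fin (F.P K).d → Site (F.P K) 0 → Matrix (Fin 2) (Fin 2) ℂ) →+ (Site (F.P K) 0 → Matrix (Fin 2) (Fin 2) ℂ)),
          -- (I) the pinned `Δ_W`-biharmonic interpolant, characterised
          (∀ φ, ((∀ y : Site (F.P K) (K - n), I φ (embIter (K - n) y) = φ (embIter (K - n) y)) ∧
              ∀ x : Site (F.P K) 0, x ∉ Set.range (embIter (K - n)) →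
                divB (torusT (F.P K) 0) (fun κ z => unitsField (toUField W) ⟨z, κ⟩)
                  (fun μ => covD (torusT (F.P K) 0) (fun κ z => unitsField (toUField W) ⟨z, κ⟩) μ
                    (fun y => divB (torusT (F.P K) 0) (fun κ z => unitsField (toUField W) ⟨z, κ⟩)
                      (fun ν => covD (torusT (F.P K) 0) (fun κ z => unitsField (toUField W) ⟨z, κ⟩) ν (I φ)) y)) x = 0) ∧
            ∀ χ, (∀ y : Site (F.P K) (K - n), χ (embIter (K - n) y) = φ (embIter (K - n) y)) →
              (∀ x : Site (F.P K) 0, x ∉ Set.range (embIter (K - n)) →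
                divB (torusT (F.P K) 0) (fun κ z => unitsField (toUField W) ⟨z, κ⟩)
                  (fun μ => covD (torusT (F.P K) 0) (fun κ z => unitsField (toUField W) ⟨z, κ⟩) μ
                    (fun y => divB (torusT (F.P K) 0) (fun κ z => unitsField (toUField W) ⟨z, κ⟩)
                      (fun ν => covD (torusT (F.P K) 0) (fun κ z => unitsField (toUField W) ⟨z, κ⟩) ν χ) y)) x = 0) → χ = I φ) ∧
          -- (L) the corrector for every potential
          (∀ A φ, (∀ x, divB (torusT (F.P K) 0) (fun κ z => unitsField (toUField W) ⟨z, κ⟩)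
                (fun μ => covD (torusT (F.P K) 0) (fun κ z => unitsField (toUField W) ⟨z, κ⟩) μ φ) x
              = divB (torusT (F.P K) 0) (fun κ z => unitsField (toUField W) ⟨z, κ⟩) A x) → L A = φ - I φ) ∧
          -- pinning
          (∀ (A) (y : Site (F.P K) (K - n)), L A (embIter (K - n) y) = 0) ∧
          -- solvability
          (∀ A, ∃ φ, (∀ x, divB (torusT (F.P K) 0) (fun κ z => unitsField (toUField W) ⟨z, κ⟩)
                (fun μ => covD (torusT (F.P K) 0) (fun κ z => unitsField (toUField W) ⟨z, κ⟩) μ φ) x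
              = divB (torusT (F.P K) 0) (fun κ z => unitsField (toUField W) ⟨z, κ⟩) A x) ∧ L A = φ - I φ) ∧
          ∀ A, max ‖L A‖ (max ((F.L : ℝ) ^ (K - n) * ‖(fun μ z => covD (torusT (F.P K) 0) (fun κ z => unitsField (toUField W) ⟨z, κ⟩) μ (L A) z)‖)
              ((F.L : ℝ) ^ (K - n) * ‖(fun x => ((w x : ℝ) : ℂ) • divB (torusT (F.P K) 0) (fun κ z => unitsField (toUField W) ⟨z, κ⟩)
                (fun μ => covD (torusT (F.P K) 0) (fun κ z => unitsField (toUField W) ⟨z, κ⟩) μ (L A)) x)‖))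
            ≤ C * (((F.L : ℝ) ^ (K - n)) ^ 2 * ‖(fun x => divB (torusT (F.P K) 0) (fun κ z => unitsField (toUField W) ⟨z, κ⟩) A x)‖)) :
    (∀ (F : T3Family), F.L = L → ∀ (n K a' : ℕ) (hnK : n < K), a' + 3 ≤ F.m + n → 8 ≤ L ^ a' →
    ∀ (e : ℝ) (V : GaugeField (F.P n) 0 (Matrix.specialUnitaryGroup (Fin 2) ℂ)) (W : GaugeField (F.P K) 0 (Matrix.specialUnitaryGroup (Fin 2) ℂ)),
      0 < e → e ≤ e₆ → (L : ℝ) * ((L ^ a' : ℕ) : ℝ) * e ≤ a₅ → W ∈ regFibrePr F n K hnK.le e V → IsCritR2 F n K hnK.le V W →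
      ∀ W' : GaugeField (F.P K) 0 (Matrix.specialUnitaryGroup (Fin 2) ℂ), W' ∈ regFibrePr F n K hnK.le e V →
        ∃ Y : GaugeField (F.P K) 0 (Matrix.specialUnitaryGroup (Fin 2) ℂ), Y ∈ regFibrePr F n K hnK.le e V ∧ wilsonAction4 W' = wilsonAction4 Y ∧
          (∀ b : PBond (F.P K) 0, ‖((Y b * (W b)⁻¹ : Matrix.specialUnitaryGroup (Fin 2) ℂ) : Matrix (Fin 2) (Fin 2) ℂ) - 1‖
            ≤ sQ * ((F.L : ℝ) ^ (K - n))⁻¹) ∧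
          (∀ x : Site (F.P K) 0, x ∉ Set.range (embIter (K - n)) →
            divB (torusT (F.P K) 0) (fun κ z => unitsField (toUField W) ⟨z, κ⟩)
              (fun μ z => covD (torusT (F.P K) 0) (fun κ z => unitsField (toUField W) ⟨z, κ⟩) μ
                (fun y => divB (torusT (F.P K) 0) (fun κ z => unitsField (toUField W) ⟨z, κ⟩)
                  (fun κ z => Complex.I • ((-Complex.I) • mlog ((Y ⟨z, κ⟩ * (W ⟨z, κ⟩)⁻¹ : Matrix.specialUnitaryGroup (Fin 2) ℂ) : Matrix (Fin 2) (Fin 2) ℂ))) y) z) x = 0)) := by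
  intro F hF n K a' hnK hsize hM8 e V W he hee hMα hW hcrit W' hW'
  obtain ⟨A₀, u, Fr, a₀, a₁, hW'eq, hA0, hs₀, hs₁, hσ, hFr, hFr1, ha₀, ha₁, hc₀, hc₁, hA⟩ :=
    hDatumM F hF n K a' hnK hsize hM8 e V W he hee hMα hW W' hW'
  subst hW'eq
  subst hsQ
  have hk1 : 1 ≤ K - n := by omega
  have hs40' : 40 * s ≤ (F.L : ℝ) ^ (K - n) := by
    rw [hF]
    exact forty_mul_le_pow (le_of_lt (hF ▸ F.hL.2)) hk1 hs40
  have hd : ((F.P K).d : ℝ) = 3 := by rw [T3Family.P_d]; norm_num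
  have hS₂' : (s₁' + ((F.P K).d : ℝ) * (((2 * (c₁ + 2 * c₀ ^ 2) + 24 * c₀ + 24) * (2 * σ)) + 9 * ((6 + 2 * c₀) * (2 * σ)) ^ 2 + 36 * σ * ((2 * (c₁ + 2 * c₀ ^ 2) + 24 * c₀ + 24) * (2 * σ))) + ((F.P K).d : ℝ) * (6 * ((6 + 2 * c₀) * (2 * σ)) * s₀ + 4 * s₀ * ((1 + 6 * σ) * ((6 + 2 * c₀) * (2 * σ))))) ≤ s := by
    rw [hd]; exact hS₂
  exact pinnedSlice_of_untwistedStart_of_linCorrRow F hnK.le hk1 he.le W A₀ hA0 hs₀ hs₀' hs₁ u hW' hσ hσ0 hσc Fr hFr hFr1 ha₀ ha₁ hc₀ hc₁ hA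
    hC (hLrowM F hF n K a' hnK hsize hM8 e V W he hee hMα hW) hS₁ hS₂' hs40' hwin1 hwin2


/-- ★★★ **THE (E1) CONJUNCT AT THE MEMBERS OF RECORD FROM THE EX KNIT'S [B8]-THEOREM-2 BINDER `hThm2S`, THE (E1-b) L-ROW AND L-ONLY WINDOWS** — ✓ `hDatum_of_thm2S_member`
(ym3-torus-px13 g4) ∘ `pinnedSliceRow_member_of_thm2Datum`: for `ℓ ≥ 4`, `L = ℓ + 1`, Thm-2 constants `B₁ c₁ > 0` with the interface `Thm2SetupSUAt … (fun _ => True)` at every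
member, there are L-only `B₁′ c₁′ c35 a₅ > 0` such that for every radius `e₆ > 0` in print's numeric windows (those of ✓ `hDatum_of_thm2S_member`) and every `s C sQ` in the
door's windows at `s₀ := 2B₁′e₆`, `s₁′ := 6B₁′e₆`, `σ := 240B₁′e₆`, `c₀ = c₁ := c35·a₅·e^{c35·a₅}`, `sQ = 2s + 9Cs`: the member-prefixed L-row `hLrowM` (displayed; its
supplier is ✓ `hLrow_of_hKsup_member` ∘ ✓ `hKsup_member`) implies the (E1) conjunct behind the member prefix.  The E1 side's print content is then ONE letter: `hThm2S`.
[cite: Balaban1985RegularSpaces, Thm 2 p.83, (1.36) p.82, (1.72) p.88; Balaban1985Variational, Prop. 2 p.281, Prop. 7 p.299, (141)-(143) p.299; Balaban1985BackgroundPropagators, (3.35) p.396] -/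
theorem pinnedSliceRow_member_of_thm2S {ℓ : ℕ} (hℓ4 : 4 ≤ ℓ) (hL : Odd (ℓ + 1) ∧ 1 < ℓ + 1) {B₁ c₁ : ℝ} (hB₁ : 0 < B₁) (hc₁ : 0 < c₁)
    (hThm2S : ∀ (F : T3Family), F.L = ℓ + 1 → ∀ (n K : ℕ), n < K →
      ∃ (β₀ B₂ : ℝ) (len : LSite (F.P K).d → ℝ), Thm2SetupSUAt (F.P K) 2 (K - n) (eta F n K) β₀ B₁ B₂ c₁ len (fun _ => True)) :
    ∃ B₁' c₁' c35 a₅ : ℝ, 0 < B₁' ∧ 0 < c₁' ∧ 0 < c35 ∧ 0 < a₅ ∧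
    ∀ (e₆ s C sQ : ℝ), 0 < e₆ → 2 * e₆ ≤ c₁' →
      -- print's numeric windows at `e₆` (✓ `hDatum_of_thm2S_member`, VERBATIM)
      C0 3 * (2 * e₆) ≤ 1 / 3 → 8 * e₆ ≤ c2' 3 (ℓ + 1) →
      Real.exp (4 * (800 * ((3 : ℝ) + 1) ^ 2 * ((3 : ℝ) + 4)) * (2 * e₆)) * (1 + 8 * (131072 * ((3 : ℝ) + 1) ^ 2) * (2 * B₁' * e₆)) ≤ 2 →
      2 * (2 * B₁' * e₆) ≤ c3 3 (ℓ + 1) → 128 * (3 : ℝ) * (2 * B₁' * e₆) ≤ 1 →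
      -- the door's windows at the member constants (✓ `pinnedSliceRow_of_thm2Datum`, `s₀ := 2B₁′e₆`, `s₁′ := 6B₁′e₆`, `σ := 240B₁′e₆`, `c₀ = c₁ := c35·a₅·e^{c35·a₅}`)
      0 ≤ C → (2 * B₁' * e₆) ≤ 1 / 64 → (240 * B₁' * e₆) ≤ 1 / 1024 → ((6 + 2 * (c35 * a₅ * Real.exp (c35 * a₅))) * (2 * (240 * B₁' * e₆))) ≤ 1 / 256 →
      ((2 * B₁' * e₆) + (1 + 2 * (2 * B₁' * e₆)) * ((1 + 6 * (240 * B₁' * e₆)) * ((6 + 2 * (c35 * a₅ * Real.exp (c35 * a₅))) * (2 * (240 * B₁' * e₆))))) ≤ s →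
      ((6 * B₁' * e₆) + (3 : ℝ) * (((2 * ((c35 * a₅ * Real.exp (c35 * a₅)) + 2 * (c35 * a₅ * Real.exp (c35 * a₅)) ^ 2) + 24 * (c35 * a₅ * Real.exp (c35 * a₅)) + 24) * (2 * (240 * B₁' * e₆))) + 9 * ((6 + 2 * (c35 * a₅ * Real.exp (c35 * a₅))) * (2 * (240 * B₁' * e₆))) ^ 2 + 36 * (240 * B₁' * e₆) * ((2 * ((c35 * a₅ * Real.exp (c35 * a₅)) + 2 * (c35 * a₅ * Real.exp (c35 * a₅)) ^ 2) + 24 * (c35 * a₅ * Real.exp (c35 * a₅)) + 24) * (2 * (240 * B₁' * e₆)))) + (3 : ℝ) * (6 * ((6 + 2 * (c35 * a₅ * Real.exp (c35 * a₅))) * (2 * (240 * B₁' * e₆))) * (2 * B₁' * e₆) + 4 * (2 * B₁' * e₆) * ((1 + 6 * (240 * B₁' * e₆)) * ((6 + 2 * (c35 * a₅ * Real.exp (c35 * a₅))) * (2 * (240 * B₁' * e₆)))))) ≤ s →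
      40 * s ≤ ((ℓ + 1 : ℕ) : ℝ) → 1800 * C * s ≤ 1 → 3 / 2 * C * (400 * (1 + 3)) * (7 * (3 / 2 * C) * s + s) ≤ 1 / 2 → sQ = 2 * s + 9 * C * s →
    -- the (E1-b) L-row at the members (displayed)
        (∀ (F : T3Family), F.L = ℓ + 1 → ∀ (n K a' : ℕ) (hnK : n < K), a' + 3 ≤ F.m + n → 8 ≤ (ℓ + 1) ^ a' →
    ∀ (e : ℝ) (V : GaugeField (F.P n) 0 (Matrix.specialUnitaryGroup (Fin 2) ℂ)) (W : GaugeField (F.P K) 0 (Matrix.specialUnitaryGroup (Fin 2) ℂ)),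
      0 < e → e ≤ e₆ → ((ℓ + 1 : ℕ) : ℝ) * (((ℓ + 1) ^ a' : ℕ) : ℝ) * e ≤ a₅ → W ∈ regFibrePr F n K hnK.le e V →
      ∀ (w : Site (F.P K) 0 → ℝ), (∀ (x : Site (F.P K) 0) (y : Site (F.P K) (K - n)), w x ≤ (Site.tdist x (embIter (K - n) y) : ℝ)) →
          (∀ x, w x ≤ (F.L : ℝ) ^ (K - n)) → (∀ x, 0 ≤ w x) →
        ∃ (I : (Site (F.P K) 0 → Matrix (Fin 2) (Fin 2) ℂ) →+ (Site (F.P K) 0 → Matrix (Fin 2) (Fin 2) ℂ))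
          (L : (Fin (F.P K).d → Site (F.P K) 0 → Matrix (Fin 2) (Fin 2) ℂ) →+ (Site (F.P K) 0 → Matrix (Fin 2) (Fin 2) ℂ)),
          -- (I) the pinned `Δ_W`-biharmonic interpolant, characterised
          (∀ φ, ((∀ y : Site (F.P K) (K - n), I φ (embIter (K - n) y) = φ (embIter (K - n) y)) ∧
              ∀ x : Site (F.P K) 0, x ∉ Set.range (embIter (K - n)) →
                divB (torusT (F.P K) 0) (fun κ z => unitsField (toUField W) ⟨z, κ⟩)
                  (fun μ => covD (torusT (F.P K) 0) (fun κ z => unitsField (toUField W) ⟨z, κ⟩) μ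
                    (fun y => divB (torusT (F.P K) 0) (fun κ z => unitsField (toUField W) ⟨z, κ⟩)
                      (fun ν => covD (torusT (F.P K) 0) (fun κ z => unitsField (toUField W) ⟨z, κ⟩) ν (I φ)) y)) x = 0) ∧
            ∀ χ, (∀ y : Site (F.P K) (K - n), χ (embIter (K - n) y) = φ (embIter (K - n) y)) →
              (∀ x : Site (F.P K) 0, x ∉ Set.range (embIter (K - n)) →
                divB (torusT (F.P K) 0) (fun κ z => unitsField (toUField W) ⟨z, κ⟩)
                  (fun μ => covD (torusT (F.P K) 0) (fun κ z => unitsField (toUField W) ⟨z, κ⟩) μ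
                    (fun y => divB (torusT (F.P K) 0) (fun κ z => unitsField (toUField W) ⟨z, κ⟩)
                      (fun ν => covD (torusT (F.P K) 0) (fun κ z => unitsField (toUField W) ⟨z, κ⟩) ν χ) y)) x = 0) → χ = I φ) ∧
          -- (L) the corrector for every potential
          (∀ A φ, (∀ x, divB (torusT (F.P K) 0) (fun κ z => unitsField (toUField W) ⟨z, κ⟩)
                (fun μ => covD (torusT (F.P K) 0) (fun κ z => unitsField (toUField W) ⟨z, κ⟩) μ φ) x
              = divB (torusT (F.P K) 0) (fun κ z => unitsField (toUField W) ⟨z, κ⟩) A x) → L A = φ - I φ) ∧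
          -- pinning
          (∀ (A) (y : Site (F.P K) (K - n)), L A (embIter (K - n) y) = 0) ∧
          -- solvability
          (∀ A, ∃ φ, (∀ x, divB (torusT (F.P K) 0) (fun κ z => unitsField (toUField W) ⟨z, κ⟩)
                (fun μ => covD (torusT (F.P K) 0) (fun κ z => unitsField (toUField W) ⟨z, κ⟩) μ φ) x
              = divB (torusT (F.P K) 0) (fun κ z => unitsField (toUField W) ⟨z, κ⟩) A x) ∧ L A = φ - I φ) ∧
          ∀ A, max ‖L A‖ (max ((F.L : ℝ) ^ (K - n) * ‖(fun μ z => covD (torusT (F.P K) 0) (fun κ z => unitsField (toUField W) ⟨z, κ⟩) μ (L A) z)‖)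
              ((F.L : ℝ) ^ (K - n) * ‖(fun x => ((w x : ℝ) : ℂ) • divB (torusT (F.P K) 0) (fun κ z => unitsField (toUField W) ⟨z, κ⟩)
                (fun μ => covD (torusT (F.P K) 0) (fun κ z => unitsField (toUField W) ⟨z, κ⟩) μ (L A)) x)‖))
            ≤ C * (((F.L : ℝ) ^ (K - n)) ^ 2 * ‖(fun x => divB (torusT (F.P K) 0) (fun κ z => unitsField (toUField W) ⟨z, κ⟩) A x)‖)) →
    (∀ (F : T3Family), F.L = ℓ + 1 → ∀ (n K a' : ℕ) (hnK : n < K), a' + 3 ≤ F.m + n → 8 ≤ (ℓ + 1) ^ a' →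
    ∀ (e : ℝ) (V : GaugeField (F.P n) 0 (Matrix.specialUnitaryGroup (Fin 2) ℂ)) (W : GaugeField (F.P K) 0 (Matrix.specialUnitaryGroup (Fin 2) ℂ)),
      0 < e → e ≤ e₆ → ((ℓ + 1 : ℕ) : ℝ) * (((ℓ + 1) ^ a' : ℕ) : ℝ) * e ≤ a₅ → W ∈ regFibrePr F n K hnK.le e V → IsCritR2 F n K hnK.le V W →
      ∀ W' : GaugeField (F.P K) 0 (Matrix.specialUnitaryGroup (Fin 2) ℂ), W' ∈ regFibrePr F n K hnK.le e V →
        ∃ Y : GaugeField (F.P K) 0 (Matrix.specialUnitaryGroup (Fin 2) ℂ), Y ∈ regFibrePr F n K hnK.le e V ∧ wilsonAction4 W' = wilsonAction4 Y ∧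
          (∀ b : PBond (F.P K) 0, ‖((Y b * (W b)⁻¹ : Matrix.specialUnitaryGroup (Fin 2) ℂ) : Matrix (Fin 2) (Fin 2) ℂ) - 1‖
            ≤ sQ * ((F.L : ℝ) ^ (K - n))⁻¹) ∧
          (∀ x : Site (F.P K) 0, x ∉ Set.range (embIter (K - n)) →
            divB (torusT (F.P K) 0) (fun κ z => unitsField (toUField W) ⟨z, κ⟩)
              (fun μ z => covD (torusT (F.P K) 0) (fun κ z => unitsField (toUField W) ⟨z, κ⟩) μ
                (fun y => divB (torusT (F.P K) 0) (fun κ z => unitsField (toUField W) ⟨z, κ⟩)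
                  (fun κ z => Complex.I • ((-Complex.I) • mlog ((Y ⟨z, κ⟩ * (W ⟨z, κ⟩)⁻¹ : Matrix.specialUnitaryGroup (Fin 2) ℂ) : Matrix (Fin 2) (Fin 2) ℂ))) y) z) x = 0)) := by
  obtain ⟨B₁', c₁', c35, a₅, hB₁', hc₁', hc35, ha₅, HP3⟩ := hDatum_of_thm2S_member hℓ4 hL hB₁ hc₁ hThm2S
  refine ⟨B₁', c₁', c35, a₅, hB₁', hc₁', hc35, ha₅, ?_⟩
  intro e₆ s C sQ he₆ h2e₆ hw1 hw2 hw3 hw4 hw5 hC hs₀' hσ0 hσc hS₁ hS₂ hs40 hwin1 hwin2 hsQ hLrowM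
  exact pinnedSliceRow_member_of_thm2Datum (ℓ + 1) hC hs₀' hσ0 hσc hS₁ hS₂ hs40 hwin1 hwin2 hsQ (HP3 e₆ he₆ h2e₆ hw1 hw2 hw3 hw4 hw5) hLrowM

end Summit.QuantumFields.YangMills.Theorems.Prop7PinnedSliceRowMember

end
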